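import Summits.Ventures.HSemireg.WedgeHankelRecurrenceInertia

/-!
# Venture HSemireg — THE RANK OF A SYMMETRIC MATRIX IS ITS INERTIA RANK: over a linearly ordered field, for every symmetric `A`, **`rank A = sigPos (v ↦ vᵀAv) + sigNeg (v ↦ vᵀAv)`** (the radical of the form is
# `ker A`; Mathlib's `sigPos + sigNeg + dim radical = dim`); hence for the Hankel form of finitely many geometric sequences `q_j = Σ_{c∈S} w(c) c^j` (`|S| ≤ t + 1`) **`rank H_t(q) = #{c ∈ S | w(c) ≠ 0}`** for EVERY
# size `t + 1 ≥ |S|` — BPR's «Rank(Her(P,Q)) = #{x | P(x) = 0 ∧ Q(x) ≠ 0}» as a MATRIX rank, complementing N113 (square size = degree) and N126 (inertia rank)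

HONEST FRAMING. Part of the Lean index of the computation cell `pub-hsemireg` (seat p10 gen 33, Sunday typer «UNIFORM-IN-n»).
LINEAR ALGEBRA OF QUADRATIC FORMS AND HANKEL (catalecticant) MATRICES over a field ONLY (Mathlib's `sigPos` ∕ `sigNeg`, `QuadraticMap.radical`, `Matrix.rank`): no variety, no cohomology theory, no sheaf, no Ext
group and no semiregularity map is constructed here; nothing here says that HC / HC_CM / HC_AV holds; no Literature fact is declared or used.
SOURCE (classical): Sylvester's law of inertia with the rank (BPR §4.3.1 Thm. 4.38 ∕ Cor. 4.39 «`Rank(Φ) = r₊ + r₋`»); Mathlib `QuadraticForm.sigPos_add_sigNeg_add_radical` (2026) and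
`QuadraticMap.radical_eq_ker_polarBilin`.
DEDUP DISCLOSURE (`rg` of the whole tree): PROVED Literature `Topology/FourManifolds/LatticeFormsSylvester.sigPos_add_sigNeg_eq_finrank_of_isSymm` is the NONDEGENERATE case (`sigPos + sigNeg = finrank` for a symmetric
bilinear form with trivial kernel, over Noetherian rings); `Combinatorics/LorentzianPolynomials/*` use it for Hessians; `Algebra/Polynomial/TraceFormSignature.sigPos_add_sigNeg_eq_finrank_range` is the trace-form
case.  The general «matrix rank = inertia rank» for a possibly DEGENERATE symmetric matrix, and the Hankel corollaries, are not in the tree (`rg "rank.*sigPos"`).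

WHAT IS IN THE TREE.  N126 (`WedgeHankelRecurrenceInertia`): `toQuadraticForm'_hankelSq_apply`, `sigPos_add_sigNeg_toQuadraticForm'_hankelSq_of_eq_sum`, `sigPos/sigNeg_toQuadraticForm'_hankelSq_of_eq_sum`.  PROVED
Literature `QuadraticFormDeterminantCharTwo.toQuadraticForm'_apply`.  Mathlib: `QuadraticMap.radical_eq_ker_polarBilin`, `QuadraticMap.polarBilin_toQuadraticMap`, `QuadraticForm.sigPos_add_sigNeg_add_radical`,
`Matrix.rank`, `LinearMap.finrank_range_add_finrank_ker`, `Matrix.dotProduct_mulVec`, `Matrix.vecMul_transpose`, `dotProduct_single`.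
THIS FILE (namespace `Summit.Ventures.HSemireg.Wedge.HankelOuter` continued; PLAIN on N126; 0 definitions):
* §717 `toLinearMap₂'_flip_apply_of_isSymm` (`B(w, v) = B(v, w)` for symmetric `A`), `polarBilin_toQuadraticForm'_apply` (`polar = 2·vᵀAw`), **`radical_toQuadraticForm'_eq_ker`** (`rad(vᵀAv) = ker A`, symmetric `A`,
  ordered field), **`rank_eq_sigPos_add_sigNeg`** (`rank A = sigPos + sigNeg`), `hankelSq_isSymm`, **`rank_hankelSq_eq_sigPos_add_sigNeg`**, **`rank_hankelSq_of_eq_sum`** (`rank H_t(Σ_c w(c) c^j) = #{w ≠ 0}`, `|S| ≤ t+1`),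
  `rank_hankelSq_of_eq_sum_le` (`≤ |S|`), `det_hankelSq_of_eq_sum_ne_zero_iff` (`det ≠ 0 ⟺ |S| = t + 1 ∧ all w(c) ≠ 0`).
Nothing Ext-side.  New names only.
-/

open Module Polynomial
open scoped Matrix Polynomial

namespace Summit.Ventures.HSemireg.Wedge.HankelOuter

open Summit.Ventures.HSemireg.Wedge Summit.Ventures.HSemireg.Wedge.Hankel

/-! ## §717. Matrix rank = inertia rank for symmetric matrices; the rank of a Hankel matrix of finitely many geometric sequences -/

section Symm

variable {K : Type*} [Field K] {n : Type*} [Fintype n] [DecidableEq n]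

/-- For a symmetric matrix the bilinear form `(v, w) ↦ v ⬝ (A w)` is symmetric. [bookkeeping] -/
theorem toLinearMap₂'_apply_comm_of_isSymm {A : Matrix n n K} (hA : A.IsSymm) (v w : n → K) : Matrix.toLinearMap₂' K A w v = Matrix.toLinearMap₂' K A v w := by
  rw [Matrix.toLinearMap₂'_apply', Matrix.toLinearMap₂'_apply', Matrix.dotProduct_mulVec, ← Matrix.mulVec_transpose, hA.eq, dotProduct_comm]

/-- The polar form of `v ↦ vᵀ A v` is `(v, w) ↦ 2 · vᵀ A w` for symmetric `A`. [bookkeeping] -/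
theorem polarBilin_toQuadraticForm'_apply {A : Matrix n n K} (hA : A.IsSymm) (v w : n → K) : QuadraticMap.polarBilin A.toQuadraticForm' v w = 2 * (v ⬝ᵥ (A *ᵥ w)) := by
  rw [Matrix.toQuadraticForm', LinearMap.BilinMap.polarBilin_toQuadraticMap, LinearMap.add_apply, LinearMap.add_apply, LinearMap.flip_apply, toLinearMap₂'_apply_comm_of_isSymm hA v w,
    Matrix.toLinearMap₂'_apply', two_mul]

/-- `v ⬝ (A w) = 0` for all `v` forces `A w = 0`. [bookkeeping] -/
theorem mulVec_eq_zero_of_forall_dotProduct_eq_zero (A : Matrix n n K) {w : n → K} (h : ∀ v : n → K, v ⬝ᵥ (A *ᵥ w) = 0) : A *ᵥ w = 0 := by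
  funext i
  have hi := h (Pi.single i 1)
  rwa [single_one_dotProduct] at hi

variable [LinearOrder K] [IsStrictOrderedRing K]

/-- **The radical of `v ↦ vᵀ A v` is `ker A`** for a symmetric matrix over an ordered field (`2` is invertible, so the radical is the kernel of the polar form `2·vᵀAw`). [this file, §717] -/
theorem radical_toQuadraticForm'_eq_ker {A : Matrix n n K} (hA : A.IsSymm) : A.toQuadraticForm'.radical = LinearMap.ker A.mulVecLin := by
  haveI : Invertible (2 : K) := invertibleOfNonzero two_ne_zero
  rw [QuadraticMap.radical_eq_ker_polarBilin]
  ext w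
  simp only [LinearMap.mem_ker, Matrix.mulVecLin_apply]
  constructor
  · intro h
    refine mulVec_eq_zero_of_forall_dotProduct_eq_zero A fun v => ?_
    have hv := LinearMap.congr_fun h v
    rw [polarBilin_toQuadraticForm'_apply hA, LinearMap.zero_apply, mul_eq_zero, or_iff_right (two_ne_zero' K), ← Matrix.toLinearMap₂'_apply', ← toLinearMap₂'_apply_comm_of_isSymm hA,
      Matrix.toLinearMap₂'_apply'] at hv
    exact hv
  · intro h
    refine LinearMap.ext fun v => ?_
    rw [polarBilin_toQuadraticForm'_apply hA, LinearMap.zero_apply, ← Matrix.toLinearMap₂'_apply', ← toLinearMap₂'_apply_comm_of_isSymm hA, Matrix.toLinearMap₂'_apply', h, dotProduct_zero, mul_zero]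

/-- **MATRIX RANK = INERTIA RANK: `rank A = sigPos (vᵀAv) + sigNeg (vᵀAv)` for every symmetric matrix over a linearly ordered field** (degenerate `A` allowed; Mathlib's `sigPos + sigNeg + dim rad = dim` with `rad = ker A` and
rank–nullity). [this file, §717] -/
theorem rank_eq_sigPos_add_sigNeg {A : Matrix n n K} (hA : A.IsSymm) : A.rank = sigPos A.toQuadraticForm' + sigNeg A.toQuadraticForm' := by
  have h1 := QuadraticForm.sigPos_add_sigNeg_add_radical (Q := A.toQuadraticForm')
  rw [radical_toQuadraticForm'_eq_ker hA] at h1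
  have h2 := LinearMap.finrank_range_add_finrank_ker A.mulVecLin
  rw [← h2] at h1
  unfold Matrix.rank
  omega

end Symm

/-- A square Hankel matrix is symmetric. [bookkeeping] -/
theorem hankelSq_isSymm (K : Type*) [Field K] (t : ℕ) (q : ℕ → K) : (hankelSq K t q).IsSymm :=
  Matrix.IsSymm.ext fun i j => by rw [hankelSq, Matrix.of_apply, Matrix.of_apply, add_comm]

variable {K : Type*} [Field K] [LinearOrder K] [IsStrictOrderedRing K]

/-- **`rank H_t(q) = sigPos + sigNeg` of the Hankel form `v ↦ vᵀ H_t(q) v`** (any sequence `q`, ordered field). [this file, §717] -/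
theorem rank_hankelSq_eq_sigPos_add_sigNeg (t : ℕ) (q : ℕ → K) : (hankelSq K t q).rank = sigPos (hankelSq K t q).toQuadraticForm' + sigNeg (hankelSq K t q).toQuadraticForm' :=
  rank_eq_sigPos_add_sigNeg (hankelSq_isSymm K t q)

/-- **The rank of the Hankel matrix of finitely many geometric sequences: `q_j = Σ_{c ∈ S} w(c) c^j` with `|S| ≤ t + 1` ⇒ `rank H_t(q) = #{c ∈ S | w(c) ≠ 0}` for EVERY such size** (ordered field; BPR's
«Rank(Her(P,Q)) = #{x | P(x)=0 ∧ Q(x)≠0}» with abstract nodes, as a matrix rank). [this file, §717] -/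
theorem rank_hankelSq_of_eq_sum [DecidableEq K] (S : Finset K) (w : K → K) {t : ℕ} (hS : S.card ≤ t + 1) {q : ℕ → K} (hq : ∀ j, q j = ∑ c ∈ S, w c * c ^ j) :
    (hankelSq K t q).rank = (S.filter fun c => w c ≠ 0).card := by
  rw [rank_hankelSq_eq_sigPos_add_sigNeg, sigPos_add_sigNeg_toQuadraticForm'_hankelSq_of_eq_sum S w hS hq]

/-- In particular `rank H_t(q) ≤ |S|` (every vanishing weight drops the rank by one). [this file, §717] -/
theorem rank_hankelSq_of_eq_sum_le [DecidableEq K] (S : Finset K) (w : K → K) {t : ℕ} (hS : S.card ≤ t + 1) {q : ℕ → K} (hq : ∀ j, q j = ∑ c ∈ S, w c * c ^ j) :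
    (hankelSq K t q).rank ≤ S.card := by
  rw [rank_hankelSq_of_eq_sum S w hS hq]
  exact Finset.card_filter_le _ _

/-- **`det H_t(q) ≠ 0 ⟺ |S| = t + 1` and every weight is non-zero** (`q_j = Σ_{c∈S} w(c) c^j`, `|S| ≤ t + 1`, ordered field): full rank needs `t + 1` nodes, all weighted. [this file, §717] -/
theorem det_hankelSq_of_eq_sum_ne_zero_iff [DecidableEq K] (S : Finset K) (w : K → K) {t : ℕ} (hS : S.card ≤ t + 1) {q : ℕ → K} (hq : ∀ j, q j = ∑ c ∈ S, w c * c ^ j) :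
    (hankelSq K t q).det ≠ 0 ↔ S.card = t + 1 ∧ ∀ c ∈ S, w c ≠ 0 := by
  rw [← rank_hankelSq_eq_iff_det_ne_zero, rank_hankelSq_of_eq_sum S w hS hq]
  constructor
  · intro h
    have hle : (S.filter fun c => w c ≠ 0).card ≤ S.card := Finset.card_filter_le _ _
    have hS' : S.card = t + 1 := le_antisymm hS (h ▸ hle)
    refine ⟨hS', fun c hc => ?_⟩
    have heq : (S.filter fun c => w c ≠ 0) = S := Finset.eq_of_subset_of_card_le (Finset.filter_subset _ _) (by rw [h, hS'])
    rw [← heq] at hc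
    exact (Finset.mem_filter.1 hc).2
  · rintro ⟨hS', hw⟩
    rw [Finset.filter_true_of_mem hw, hS']

end Summit.Ventures.HSemireg.Wedge.HankelOuter
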